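import Literature.AnabelianGeometry.AbsoluteAnabelian.AbsTopII.InertiaDecompositionBranch
import Literature.AnabelianGeometry.AbsoluteAnabelian.AbsTopII.Prop13SmoothCurveModel

/-!
# [AbsTopII] Prop 1.3 (viii) with the printed scope (`Prop_1_3_viii'`) at SMOOTH-CURVE-SHAPE data: closer + model

S. Mochizuki, *Topics in Absolute Anabelian Geometry II* [AbsTopII] (bib `MochizukiAbsTopII2013`;
locators = PDF pages of the kurims manuscript `paper:url-585b8d0ad0d9`), §1, Prop 1.3 (viii) p. 12:

> "(viii) Let `e`, `e′` be edges of `𝔾`. If `D_e ∩ D_{e′} ∩ Π_I ≠ {1}`, then one of the following two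
> [mutually exclusive] properties holds: (1) `e = e′`; (2) `e` and `e′` are distinct, but abut to the same
> vertex `v`, and `D_e ∩ D_{e′} ∩ Π_𝔾 = {1}`. Moreover, in the situation of (2), [for appropriate choices
> of conjugates of the various inertia and decomposition groups involved] we have `I_v = D_e ∩ D_{e′} ∩ Π_I`."

PROOF-ONLY (no definition), abc-iut-L4-t6 lineage (typer of record of `DPSCIndexData.Prop_1_3_viii'`,
`AbsTopII/InertiaGroupsScope.lean` p427207), cell row «P13viii′-SMOOTH-SHAPE».  abc-iut-f-069's coverage
census (13:11Z) lists (viii′) among the clauses with NO closer at constructed data.  At data of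
SMOOTH-CURVE SHAPE — no node, one vertex `v`, `Π_v = Π_𝔾` — the dichotomy and its «Moreover» follow from
three printed-type inputs by pure group theory:

* [CombGC] Prop 1.2 (ii): the cuspidal subgroups are commensurably terminal in `Π_𝔾` (so
  `D_e ∩ Π_𝔾 = N_{Π_H}(Π_e) ∩ Π_𝔾 = Π_e`, this cell's `normalizer_inf_eq_of_ctIn`);
* MALNORMALITY of the cusp groups in `Π_𝔾`: `Π_e ∩ γ·Π_{e′}·γ⁻¹ ≠ 1`, `γ ∈ Π_𝔾` ⇒ `e = e′` ([SemiAnbd] Ex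
  2.10 / [AbsAnab] Lem 1.3.7; layer L3's `PSCDatum.smul_cuspGp_inf_smul_cuspGp_eq_bot` at the pro-`Σ`
  completion of `Γ_{g,r}`);
* "`I_v ↠ I`" (`I_v · Π_𝔾 = Π_I`, Prop 1.3 (iii)).

Then for `e ≠ e′` and `γ ∈ Π_𝔾`: `D_e ∩ γD_{e′}γ⁻¹ ∩ Π_𝔾 = Π_e ∩ γΠ_{e′}γ⁻¹ = 1`, and
`D_e ∩ γD_{e′}γ⁻¹ ∩ Π_I = I_v` (with the `Π_𝔾`-conjugate `h = 1`): `I_v = Z_{Π_I}(Π_𝔾)` normalises both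
cusp groups, and an element of `Π_I = I_v·Π_𝔾` normalising both has its `Π_𝔾`-part in `Π_e ∩ γΠ_{e′}γ⁻¹`.

* `prop_1_3_viii'_of_smoothCurveShape` — the ABSTRACT closer;
* `exists_smoothCurve_model_prop_1_3_viii'` — at abc-iut-f-066's smooth-curve model WITH CUSPS
  (`exists_smoothCurve_product_model`, p446583: `Π_H = Π_I = Q × Ẑ^Σ`, `Π_𝔾 = Q` a pro-`Σ` completion
  of a hyperbolic `Γ_{g,r}`, `r ≥ 1`) the typed `Prop_1_3_viii'` HOLDS — malnormality transported from L3
  along `inl : Q ↪ Q × Ẑ^Σ`; instance: `exists_tripodType_model_prop_1_3_viii'`.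

HONEST FRAMING: classical group theory over abstract DPSC data + a constructed model (constructed ≠
geometric); the inputs are named hypotheses of (T1); typed ≠ proved beyond them; nothing here bears on
[IUTchIII] Cor 3.12.
-/

open scoped Pointwise

universe u

namespace Literature.AnabelianGeometry.AbsoluteAnabelian

open Literature.AnabelianGeometry.SemiGraphs
open Literature.GroupTheory.CombinatorialGroupTheory

/-! ## A transport lemma along an injective homomorphism -/

section Transport

variable {P E : Type u} [Group P] [Group E]

/-- `ι(q·K·q⁻¹) = ι(q)·ι(K)·ι(q)⁻¹` (`ConjAct` spelling on the left, `MulAut.conj` on the right).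
[cite: MochizukiAbsTopII2013, Def 1.2 (ii) p.10] -/
theorem map_toConjAct_smul_eq_conj_smul_map' (ι : P →* E) (q : P) (K : Subgroup P) :
    (ConjAct.toConjAct q • K).map ι = MulAut.conj (ι q) • K.map ι := by
  apply le_antisymm
  · rintro _ ⟨y, hy, rfl⟩
    rw [SetLike.mem_coe, Subgroup.mem_smul_pointwise_iff_exists] at hy
    obtain ⟨k, hk, rfl⟩ := hy
    rw [Subgroup.mem_smul_pointwise_iff_exists]
    refine ⟨ι k, Subgroup.mem_map_of_mem ι hk, ?_⟩
    rw [ConjAct.toConjAct_smul, MulAut.smul_def, MulAut.conj_apply, map_mul, map_mul, map_inv]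
  · intro x h
    rw [Subgroup.mem_smul_pointwise_iff_exists] at h
    obtain ⟨_, ⟨k, hk, rfl⟩, rfl⟩ := h
    refine ⟨ConjAct.toConjAct q • k, Subgroup.smul_mem_pointwise_smul _ _ _ hk, ?_⟩
    rw [ConjAct.toConjAct_smul, MulAut.smul_def, MulAut.conj_apply, map_mul, map_mul, map_inv]

end Transport

namespace AbsTopII.DPSCIndexData

variable (X : DPSCIndexData.{u})

/-! ## (T1) The abstract closer at smooth-curve-shape data -/

/-- **[AbsTopII] Prop 1.3 (viii) with the printed scope (`Prop_1_3_viii'`) at SMOOTH-CURVE-SHAPE data**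
(no node, one vertex, `Π_v = Π_𝔾`) from: [CombGC] Prop 1.2 (ii) for the cusps (commensurable
terminality in `Π_𝔾`), malnormality of the cusp groups in `Π_𝔾`, and "`I_v · Π_𝔾 = Π_I`".  For distinct
cusps `e ≠ e′` and `γ ∈ Π_𝔾`: `D_e ∩ γD_{e′}γ⁻¹ ∩ Π_𝔾 = Π_e ∩ γΠ_{e′}γ⁻¹ = 1` and the «Moreover»
`D_e ∩ γD_{e′}γ⁻¹ ∩ Π_I = I_v` with the `Π_𝔾`-conjugate `h = 1`.
[cite: MochizukiAbsTopII2013, Prop 1.3 (viii) p.12] -/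
theorem prop_1_3_viii'_of_smoothCurveShape [IsEmpty X.Node] (hV : ∀ v w : X.Vert, v = w)
    (hvs : ∀ v, X.vertSub v = X.PiG)
    (hCTc : ∀ e : X.Cusp, IsCommensurablyTerminal ((X.cuspSub e).subgroupOf X.PiG))
    (hsurj : ∀ v, X.Iv v ⊔ X.PiG = X.PiI)
    (hmal : ∀ (c c' : X.Cusp) (γ : X.PiH), γ ∈ X.PiG →
      X.cuspSub c ⊓ MulAut.conj γ • X.cuspSub c' ≠ ⊥ → c = c') :
    X.Prop_1_3_viii' := by
  haveI : X.PiG.Normal := X.normal_PiG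
  intro e e' γ hγ hne
  rcases e with n | c
  · exact isEmptyElim n
  rcases e' with n' | c'
  · exact isEmptyElim n'
  by_cases hcc : c = c'
  · exact Or.inl (by rw [hcc])
  right
  -- the two cusp groups `A = Π_c`, `B = γΠ_{c'}γ⁻¹` and their normalisers
  set A : Subgroup X.PiH := X.cuspSub c with hA
  set B : Subgroup X.PiH := MulAut.conj γ • X.cuspSub c' with hB
  have hDA : X.DEdge (Sum.inr c) = Subgroup.normalizer (A : Set X.PiH) := rfl
  have hDB : MulAut.conj γ • X.DEdge (Sum.inr c') = Subgroup.normalizer (B : Set X.PiH) :=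
    X.conj_DEdge_eq_normalizer (Sum.inr c') γ
  have hAle : A ≤ X.PiG := X.cuspSub_le c
  have hBle : B ≤ X.PiG := by
    rw [hB, ← Subgroup.conj_smul_eq_self_of_mem hγ]
    exact Subgroup.pointwise_smul_le_pointwise_smul_iff.mpr (X.cuspSub_le c')
  -- `N(A) ∩ Π_𝔾 = A`, `N(B) ∩ Π_𝔾 = B` (commensurable terminality, transported for `B`)
  have hNA : Subgroup.normalizer (A : Set X.PiH) ⊓ X.PiG = A :=
    normalizer_inf_eq_of_ctIn hAle ((isCommensurablyTerminal_subgroupOf_iff hAle).mp (hCTc c))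
  have hNA' : Subgroup.normalizer (X.cuspSub c' : Set X.PiH) ⊓ X.PiG = X.cuspSub c' :=
    normalizer_inf_eq_of_ctIn (X.cuspSub_le c')
      ((isCommensurablyTerminal_subgroupOf_iff (X.cuspSub_le c')).mp (hCTc c'))
  have hNB : Subgroup.normalizer (B : Set X.PiH) ⊓ X.PiG = B := by
    have h1 : Subgroup.normalizer (B : Set X.PiH) =
        MulAut.conj γ • Subgroup.normalizer (X.cuspSub c' : Set X.PiH) := by
      rw [← hDB]; rfl
    rw [h1]
    nth_rewrite 1 [← Subgroup.conj_smul_eq_self_of_mem hγ]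
    rw [← Subgroup.smul_inf, hNA']
  -- `A ∩ B = 1` (malnormality, `c ≠ c'`)
  have hAB : A ⊓ B = ⊥ := by
    by_contra h
    exact hcc (hmal c c' γ hγ h)
  -- (2), `Π_𝔾`-part: `N(A) ∩ N(B) ∩ Π_𝔾 = 1`
  have hG : X.DEdge (Sum.inr c) ⊓ MulAut.conj γ • X.DEdge (Sum.inr c') ⊓ X.PiG = ⊥ := by
    rw [hDA, hDB, eq_bot_iff, ← hAB]
    intro x hx
    exact ⟨hNA.le ⟨hx.1.1, hx.2⟩, hNB.le ⟨hx.1.2, hx.2⟩⟩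
  -- `I_v ≤ N(A) ∩ N(B)`: `I_v ⊆ Z(Π_𝔾)` centralises both cusp groups
  have hIle : ∀ v, X.Iv v ≤ Subgroup.normalizer (A : Set X.PiH) ⊓ Subgroup.normalizer (B : Set X.PiH) := by
    intro v x hx
    have hxZ : x ∈ Subgroup.centralizer (X.PiG : Set X.PiH) := by
      have := hx.1
      rwa [hvs v] at this
    exact ⟨Subgroup.centralizer_le_normalizer _ (Subgroup.centralizer_le (s := (A : Set X.PiH)) hAle hxZ),
      Subgroup.centralizer_le_normalizer _ (Subgroup.centralizer_le (s := (B : Set X.PiH)) hBle hxZ)⟩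
  refine ⟨fun h => hcc (Sum.inr_injective h), X.cuspVert c, rfl, hV _ _, hG, 1, X.PiG.one_mem, ?_⟩
  -- «Moreover»: `I_v = N(A) ∩ N(B) ∩ Π_I` (conjugate `h = 1`)
  rw [map_one, one_smul, hDA, hDB]
  apply le_antisymm
  · exact fun x hx => ⟨hIle _ hx, hx.2⟩
  · intro x hx
    -- `x ∈ Π_I = I_v · Π_𝔾`: `x = t * g`
    have hxI : x ∈ ((X.Iv (X.cuspVert c) ⊔ X.PiG : Subgroup X.PiH) : Set X.PiH) := by
      rw [hsurj]; exact hx.2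
    rw [Subgroup.mul_normal] at hxI
    obtain ⟨t, ht, g, hg, rfl⟩ := Set.mem_mul.mp hxI
    -- the `Π_𝔾`-part `g = t⁻¹ (t g)` normalises `A` and `B`, hence is trivial
    have hgN : g ∈ Subgroup.normalizer (A : Set X.PiH) ⊓ Subgroup.normalizer (B : Set X.PiH) := by
      have htN := hIle _ ht
      have : t⁻¹ * (t * g) ∈ Subgroup.normalizer (A : Set X.PiH) ⊓ Subgroup.normalizer (B : Set X.PiH) :=
        Subgroup.mul_mem _ (Subgroup.inv_mem _ htN) hx.1
      rwa [inv_mul_cancel_left] at this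
    have hg1 : g = 1 := by
      have : g ∈ A ⊓ B := ⟨hNA.le ⟨hgN.1, hg⟩, hNB.le ⟨hgN.2, hg⟩⟩
      rw [hAB] at this
      exact this
    rw [hg1, mul_one]
    exact ht

/-! ## (T2) The smooth-curve model with cusps -/

/-- **[AbsTopII] Prop 1.3 (viii′) HOLDS at the smooth-curve model WITH CUSPS** (abc-iut-f-066's
`exists_smoothCurve_product_model`): for every nonempty set of primes `Σ` and every hyperbolic `(g, r)`
with `r ≥ 1`, DPSC-index data with `Σ`, `r` cusps, no node and `Π_v = Π_𝔾` at which `Prop_1_3_viii'`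
holds — the malnormality input being layer L3's `PSCDatum.smul_cuspGp_inf_smul_cuspGp_eq_bot` transported
along `inl : Q ↪ Q × Ẑ^Σ`. [cite: MochizukiAbsTopII2013, Prop 1.3 (viii) p.12] -/
theorem exists_smoothCurve_model_prop_1_3_viii' (Sigma : Set ℕ) (hS₁ : Sigma.Nonempty)
    (hS₂ : ∀ p ∈ Sigma, p.Prime) (g r : ℕ) (hgr : PuncturedSurfaceGroup.IsHyperbolicType g r)
    (hr : 0 < r) :
    ∃ X : DPSCIndexData.{0}, X.Sigma = Sigma ∧ Nonempty (X.Cusp ≃ Fin r) ∧ IsEmpty X.Node ∧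
      (∀ v, X.vertSub v = X.PiG) ∧
      Literature.AnabelianGeometry.AbsoluteAnabelian.AbsTopII.DPSCIndexData.Prop_1_3_viii' X := by
  obtain ⟨Q, ι₀, hι₀, Z, hZ, G, hιr, hιn, X, -, -, -, -, -, -, -, hcusps, -, -, -, -, hXdef, hXS, -,
    hXc, hXn, -, hV, -, hvs, -, -, -, -, hCTc, -, hsurj, -⟩ :=
    exists_smoothCurve_product_model Sigma hS₁ hS₂ g r hgr hr
  obtain ⟨e, hC⟩ := hcusps
  haveI := hXn
  -- malnormality of the cusp groups at `X`, from L3 through `hXdef`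
  have hmalD : ∀ D : DPSCData.{0},
      D = DPSCData.ofEmbedding G (ProfiniteGrp.of (Q × Z)) (MonoidHom.inl Q Z) hιr hιn ⊤
        inferInstance le_top →
      ∀ (c c' : D.Cusp) (γ : D.PiH), γ ∈ D.PiG →
        D.cuspSub c ⊓ MulAut.conj γ • D.cuspSub c' ≠ ⊥ → c = c' := by
    rintro D rfl c c' γ ⟨q, rfl⟩ hne
    by_contra hcc
    apply hne
    have hcc' : c.down ≠ c'.down := fun h => hcc (ULift.ext _ _ h)
    have hinj : Function.Injective (MonoidHom.inl Q Z) := fun a b hab => by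
      have := congrArg Prod.fst hab
      simpa using this
    have h0 := PSCDatum.smul_cuspGp_inf_smul_cuspGp_eq_bot hS₁ hS₂ hgr ι₀ hι₀ G e hC hcc'
      (1 : ConjAct Q) (ConjAct.toConjAct q)
    rw [one_smul] at h0
    change (G.cuspGp c.down).map (MonoidHom.inl Q Z) ⊓
      MulAut.conj ((MonoidHom.inl Q Z) q) • (G.cuspGp c'.down).map (MonoidHom.inl Q Z) = ⊥
    rw [← map_toConjAct_smul_eq_conj_smul_map', ← Subgroup.map_inf _ _ _ hinj, h0, Subgroup.map_bot]
  have hmal := hmalD X.toDPSCData hXdef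
  exact ⟨X, hXS, hXc, hXn, hvs, X.prop_1_3_viii'_of_smoothCurveShape hV hvs hCTc hsurj hmal⟩

/-- The tripod-type instance: `Σ = {2}`, `(g, r) = (0, 3)`. [cite: MochizukiAbsTopII2013, Prop 1.3 (viii) p.12] -/
theorem exists_tripodType_model_prop_1_3_viii' :
    ∃ X : DPSCIndexData.{0}, X.Sigma = {2} ∧ Nonempty (X.Cusp ≃ Fin 3) ∧
      Literature.AnabelianGeometry.AbsoluteAnabelian.AbsTopII.DPSCIndexData.Prop_1_3_viii' X := by
  obtain ⟨X, hS, hc, -, -, h⟩ := exists_smoothCurve_model_prop_1_3_viii' {2}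
    (Set.singleton_nonempty 2) (fun p hp => by rw [Set.mem_singleton_iff.mp hp]; exact Nat.prime_two)
    0 3 (by unfold PuncturedSurfaceGroup.IsHyperbolicType; norm_num) (by norm_num)
  exact ⟨X, hS, hc, h⟩

end AbsTopII.DPSCIndexData

end Literature.AnabelianGeometry.AbsoluteAnabelian
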